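import Summits.QuantumFields.GaugeBoot.DiagonalRPTorusEvenGaugeInvariantAllGroups
import HarnessLib

/-!
# The gauge-invariant diagonal-RP classification on the two-torus, every size `L ≥ 2`, every
coupling, every compact gauge group (gauge-boot, L3 supplement — master table)

HONEST FRAMING (cell `pub-gaugeboot`, page 1 of every file): the venture produces certified bounds
on lattice expectations at stated coupling, gauge group, dimension and torus size; NOT a mass gap,
NOT a continuum limit, NOT a string tension; NOT Yang–Mills-summit-bearing (barriers
`FixedCouplingUltralocality`, `PerturbativeInvisibility`). Theorem-only packaging of the tree's
two-dimensional results; it discharges nothing else.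

With `DiagonalRPTorusEvenGaugeInvariantAllGroups.lean` (even `L ≥ 4`, every `β`, every `G`),
`DiagonalRPTorusGaugeInvariantFour.not_gaugeInvariantDiagonalRP_two_two` (`L = 2` fails at every `β`
for every non-trivial `ρ`) and `DiagonalRPTorusOddGaugeInvariantNegative.gaugeInvariantDiagonalRP_odd_iff`
(odd `L ≥ 5`: `↔ 0 ≤ β`), the closed-half diagonal reflection positivity of the Wilson state of
`(ℤ/L)²` in the GAUGE-INVARIANT sector is decided for every `L ≥ 2` except `L = 3` at `β < 0`:

* ★★★ `gaugeInvariantDiagonalRP_two_even_iff_four_le` — `L` even, `L ≥ 2`, `ρ` continuous and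
  non-trivial, EVERY real `β`: `GaugeInvariantDiagonalRP ρ β i j ↔ 4 ≤ L` (the tree's
  `gaugeInvariantDiagonalRP_two_iff` had `β ≥ 0`);
* ★★★ `gaugeInvariantDiagonalRP_two_iff_master` — `L ≥ 2`, `L ≠ 3`, `ρ` continuous with scalar
  commutant and `ρ ≢ 1`, every real `β`:
  `GaugeInvariantDiagonalRP ρ β i j ↔ (Even L ∧ 4 ≤ L) ∨ (Odd L ∧ 0 ≤ β)`;
* `gaugeInvariantDiagonalRP_two_iff_suN_master` (`SU(N)`, `N ≥ 2`), `gaugeInvariantDiagonalRP_two_iff_uN_master`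
  (`U(N)`, `N ≥ 1`).

OPEN and not claimed: `L = 3` at `β < 0` (at `β ≥ 0` it holds, tree L3(θ)); anything in `d ≥ 3`
(there the closed-half statement fails gauge-invariantly at every `β`). No certificate of the cell
sits at `β < 0`.
-/

open MeasureTheory Complex Finset Function
open scoped ComplexOrder ENNReal

namespace Summit.QuantumFields.GaugeBoot

open Literature.MathematicalPhysics.QuantumFieldTheory
open Literature.RepresentationTheory.CompactGroups

noncomputable section

namespace DiagRPTwo

section Master

variable {L N : ℕ} [NeZero L] {G : Type*} [Group G] [TopologicalSpace G] [IsTopologicalGroup G]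
  [CompactSpace G] [MeasurableSpace G] [BorelSpace G] [SecondCountableTopology G] [T2Space G]
  (ρ : G →* Matrix (Fin N) (Fin N) ℂ)

/-- ★★★ **Even two-tori, every coupling**: for `L` even, `L ≥ 2`, a continuous NON-TRIVIAL
representation `ρ` of a compact metrisable group and EVERY real `β`, the gauge-invariant closed-half
diagonal RP holds on `(ℤ/L)²` iff `4 ≤ L`. -/
theorem gaugeInvariantDiagonalRP_two_even_iff_four_le (hL : Even L) (h2 : 2 ≤ L) (hρ : Continuous ρ)
    (hρ1 : ∃ g, ρ g ≠ 1) (β : ℝ) {i j : Fin 2} (hij : i ≠ j) :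
    GaugeInvariantDiagonalRP (d := 2) (L := L) ρ β i j ↔ 4 ≤ L := by
  refine ⟨fun h => ?_, fun h4 => gaugeInvariantDiagonalRP_two_even_allGroups ρ hL h4 hρ β hij⟩
  by_contra h4
  obtain ⟨r, hr⟩ := hL
  obtain rfl : L = 2 := by omega
  exact not_gaugeInvariantDiagonalRP_two_two' ρ hρ hρ1 β hij h

/-- ★★★ **The master table**: on `(ℤ/L)²`, `L ≥ 2`, `L ≠ 3`, for a continuous `ρ` with scalar
commutant and `ρ ≢ 1` (every `SU(N)`, `U(N)`, `SO(3)`, …) and EVERY real `β`: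
`GaugeInvariantDiagonalRP ρ β i j ↔ (Even L ∧ 4 ≤ L) ∨ (Odd L ∧ 0 ≤ β)`. -/
theorem gaugeInvariantDiagonalRP_two_iff_master (h2 : 2 ≤ L) (h3 : L ≠ 3) (hρ : Continuous ρ)
    (hirr : TwistedSlab.HasScalarCommutant ρ) (hρ1 : ∃ g, ρ g ≠ 1) (β : ℝ) {i j : Fin 2} (hij : i ≠ j) :
    GaugeInvariantDiagonalRP (d := 2) (L := L) ρ β i j ↔ (Even L ∧ 4 ≤ L) ∨ (Odd L ∧ 0 ≤ β) := by
  rcases Nat.even_or_odd L with hE | hO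
  · rw [gaugeInvariantDiagonalRP_two_even_iff_four_le ρ hE h2 hρ hρ1 β hij]
    refine ⟨fun h4 => Or.inl ⟨hE, h4⟩, ?_⟩
    rintro (⟨-, h4⟩ | ⟨hO, -⟩)
    · exact h4
    · exact absurd hE (Nat.not_even_iff_odd.2 hO)
  · have h5 : 5 ≤ L := by obtain ⟨r, hr⟩ := hO; omega
    rw [gaugeInvariantDiagonalRP_odd_iff ρ hO h5 hij hρ hirr hρ1 β]
    refine ⟨fun hb => Or.inr ⟨hO, hb⟩, ?_⟩
    rintro (⟨hE, -⟩ | ⟨-, hb⟩)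
    · exact absurd hE (Nat.not_even_iff_odd.2 hO)
    · exact hb

end Master

/-! ## The concrete groups -/

section Concrete

open Literature.MathematicalPhysics.QuantumLattice

/-- ★★★ **`SU(N)` master table** (`N ≥ 2`; `(ℤ/L)²`, `L ≥ 2`, `L ≠ 3`; every real `β`):
`GaugeInvariantDiagonalRP ↔ (Even L ∧ 4 ≤ L) ∨ (Odd L ∧ 0 ≤ β)`. -/
theorem gaugeInvariantDiagonalRP_two_iff_suN_master {L N : ℕ} [NeZero L] (h2 : 2 ≤ L) (h3 : L ≠ 3)
    (hN : 2 ≤ N) (β : ℝ) {i j : Fin 2} (hij : i ≠ j) :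
    GaugeInvariantDiagonalRP (d := 2) (L := L) (fundamentalRep (Fin N)) β i j ↔
      (Even L ∧ 4 ≤ L) ∨ (Odd L ∧ 0 ≤ β) := by
  haveI : SecondCountableTopology (Matrix (Fin N) (Fin N) ℂ) :=
    inferInstanceAs (SecondCountableTopology (Fin N → Fin N → ℂ))
  haveI : SecondCountableTopology (Matrix.specialUnitaryGroup (Fin N) ℂ) :=
    Topology.IsEmbedding.subtypeVal.secondCountableTopology
  exact gaugeInvariantDiagonalRP_two_iff_master (fundamentalRep (Fin N)) h2 h3
    (continuous_fundamentalRep (Fin N)) TiltedRP.hasScalarCommutant_fundamentalRep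
    (TiltedRP.exists_fundamentalRep_ne_one hN) β hij

/-- ★★★ **`U(N)` master table** (`N ≥ 1`; `(ℤ/L)²`, `L ≥ 2`, `L ≠ 3`; every real `β`):
`GaugeInvariantDiagonalRP ↔ (Even L ∧ 4 ≤ L) ∨ (Odd L ∧ 0 ≤ β)`. -/
theorem gaugeInvariantDiagonalRP_two_iff_uN_master {L N : ℕ} [NeZero L] (h2 : 2 ≤ L) (h3 : L ≠ 3)
    (hN : 1 ≤ N) (β : ℝ) {i j : Fin 2} (hij : i ≠ j) :
    GaugeInvariantDiagonalRP (d := 2) (L := L) (unitaryFundamentalRep (Fin N) ℂ) β i j ↔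
      (Even L ∧ 4 ≤ L) ∨ (Odd L ∧ 0 ≤ β) := by
  haveI : SecondCountableTopology (Matrix (Fin N) (Fin N) ℂ) :=
    inferInstanceAs (SecondCountableTopology (Fin N → Fin N → ℂ))
  haveI : SecondCountableTopology (Matrix.unitaryGroup (Fin N) ℂ) :=
    Topology.IsEmbedding.subtypeVal.secondCountableTopology
  exact gaugeInvariantDiagonalRP_two_iff_master (unitaryFundamentalRep (Fin N) ℂ) h2 h3
    (continuous_unitaryFundamentalRep (n := Fin N) (𝕜 := ℂ)) TiltedRP.hasScalarCommutant_unitaryFundamentalRep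
    (TiltedRP.exists_unitaryFundamentalRep_ne_one hN) β hij

end Concrete

end DiagRPTwo

end

end Summit.QuantumFields.GaugeBoot
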